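import Summits.KontsevichZagierPeriods.KontsevichZagierPeriods.Theorems.SoloBlindFenceDouble
import Summits.KontsevichZagierPeriods.KontsevichZagierPeriods.Theorems.SoloBlindZetaEven
import HarnessLib

/-!
# The odd `β`-boxes inside the rules (`T2`, file E)

The **`β`-box** `Bβ_k = [(0,1)ᵏ, 1/(1 + (x₁⋯x_k)²)]` (value `Σ_m (−1)^m/(2m+1)^k = β(k)`,
Dirichlet's `L(χ₋₄, k)`; `k = 2` is Catalan's constant) is, for ODD `k = n + 2`, the image of
the tangent cell `[T_n, w]` under the cyclic tangent chart (`SoloBlindCycInverse`): for odd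
`n` the Jacobian factor is `(1 + P²)·∏W`.  Combined with the min-rotation, the fence chart, the
fence dissection and the doubling chart (`SoloBlindMinCell` … `SoloBlindFenceDouble`):

  `(2·(n+2)!)·[Bβ_{n+2}] = ((n+2)·E_{n+1})·(2α)^{n+2}`,
  `(2^{n+3}·(n+2)!)·[Bβ_{n+2}] = ((n+2)·E_{n+1})·x_π^{n+2}`      in `Q` (`n` odd),

`E_{n+1} = fenceCount n` the number of up–down permutations.  Hence every odd `β`-box lies in
the `π`-sector `M_π = K₀[x_π]` and the Kontsevich–Zagier conjecture holds for it against every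
representation in `M_π` (even zeta boxes, their products, tangent cells, …); and evaluating,
`∫ Bβ_{n+2} = (n+2)·E_{n+1}·π^{n+2}/(2^{n+3}·(n+2)!)`:  `π³/32`, `5π⁵/1536`, `61π⁷/184320`.
-/

noncomputable section

open Literature.NumberTheory.Transcendental Literature.NumberTheory.Transcendental.KZ
open Literature.ModelTheory.ExponentialFields
open MeasureTheory Set Real MvPolynomial

namespace Summit.KontsevichZagierPeriods.KontsevichZagierPeriods.Theorems

namespace SoloBlind

variable {n : ℕ}

/-! ## The `β`-box -/

/-- `x ↦ 1/(1 + (∏ xᵢ)²)` is continuous. -/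
theorem continuous_one_div_one_add_prod_sq (k : ℕ) :
    Continuous fun x : Fin k → ℝ => 1 / (1 + (∏ i, x i) ^ 2) :=
  continuous_const.div (continuous_const.add ((continuous_finsetProd _ fun i _ =>
    continuous_apply i).pow 2)) fun x => by positivity

/-- **`Bβ_k = [(0,1)ᵏ, 1/(1 + (x₁⋯x_k)²)]`**, the `β`-box (a rational KZ representation). -/
def betaBoxRep (k : ℕ) : IntegralRep k :=
  ratRep (kzOpenBox k) (fun x => 1 / (1 + (∏ i, x i) ^ 2)) 1 (1 + (∏ i, X i) ^ 2)
    (isSemialgebraic_kzOpenBox k)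
    (fun x _ => by
      have h : (0 : ℝ) < 1 + (∏ i, x i) ^ 2 := by positivity
      simpa [map_prod] using h.ne')
    (fun x _ => by simp [map_prod])
    (((continuous_one_div_one_add_prod_sq k).continuousOn.integrableOn_compact
      isCompact_Icc).mono_set fun x hx => ⟨fun i => (hx i).1.le, fun i => (hx i).2.le⟩)

/-- The value of the `β`-box is the box integral. -/
theorem betaBoxRep_value (k : ℕ) :
    (betaBoxRep k).value = ∫ x in kzOpenBox k, 1 / (1 + (∏ i, x i) ^ 2) := rfl

/-! ## The chart step (odd dimension) -/

/-- **Rule (2) along the cyclic tangent chart, odd dimension: `[T_n, w] ≡ Bβ_{n+2}`.** -/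
theorem cycPiece_equiv_betaBoxRep (hn : Odd n) :
    Equivalent (cycPiece n) (betaBoxRep (n + 2)) :=
  equivalent_of_cycChart (f := angWeight (n + 2)) (g := fun x => 1 / (1 + (∏ i, x i) ^ 2))
    (fun t _ => by
      have hP : (0 : ℝ) < 1 + (∏ i, cycChart n t i) ^ 2 := by positivity
      rw [cycJac_eq, hn.neg_one_pow, angWeight_eq]
      field_simp
      ring)
    rfl (fun t _ => by rw [cycPiece, angPiece_integrand]) rfl fun _ _ => rfl

/-! ## The identities in `Q` -/

/-- **`(2·(n+2)!)·[Bβ_{n+2}] = ((n+2)·E_{n+1})·(2a(1))ⁿ⁺²` in `Q`** (`n` odd). -/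
theorem nsmul_mkQ_betaBox (hn : Odd n) :
    (2 * (n + 2).factorial) • mkQ (of (betaBoxRep (n + 2))) =
      ((n + 2) * fenceCount n) • ((2 : K₀) • alpha 1) ^ (n + 2) := by
  rw [← mkQ_eq_mkQ_iff.mpr (cycPiece_equiv_betaBoxRep hn), nsmul_mkQ_cycPiece_fence]

/-- **`(2ⁿ⁺³·(n+2)!)·[Bβ_{n+2}] = ((n+2)·E_{n+1})·x_πⁿ⁺²` in `Q`** (`n` odd). -/
theorem nsmul_mkQ_betaBox_xPi (hn : Odd n) :
    (2 ^ (n + 3) * (n + 2).factorial) • mkQ (of (betaBoxRep (n + 2))) =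
      ((n + 2) * fenceCount n) • xPi ^ (n + 2) := by
  have h1 := nsmul_mkQ_betaBox hn
  rw [xPi_eq_two_mul, mul_pow]
  simp only [nsmul_eq_mul, Nat.cast_mul, Nat.cast_pow, Nat.cast_ofNat] at h1 ⊢
  linear_combination (2 : Q) ^ (n + 2) * h1

/-! ## The `π`-sector and the conjecture -/

/-- **`Bβ_{n+2} ∈ M_π`** (`n` odd). -/
theorem of_betaBoxRep_mem_piSector' (hn : Odd n) : of (betaBoxRep (n + 2)) ∈ piSector := by
  have h := nsmul_mkQ_betaBox_xPi hn
  have ha : (2 ^ (n + 3) * (n + 2).factorial : ℕ) ≠ 0 :=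
    Nat.mul_ne_zero (pow_ne_zero _ two_ne_zero) (Nat.factorial_ne_zero _)
  have hz : mkQ (of (betaBoxRep (n + 2))) =
      ((2 ^ (n + 3) * (n + 2).factorial : ℕ) : K₀)⁻¹ •
        (((n + 2) * fenceCount n) • xPi ^ (n + 2)) := by
    rw [← h, ← Nat.cast_smul_eq_nsmul K₀ (2 ^ (n + 3) * (n + 2).factorial),
      inv_smul_smul₀ (Nat.cast_ne_zero.mpr ha)]
  rw [mem_piSector, hz]
  exact Subalgebra.smul_mem _ (Subalgebra.nsmul_mem _
    (Subalgebra.pow_mem _ (Algebra.self_mem_adjoin_singleton K₀ xPi) _) _) _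

/-- **Every odd `β`-box `Bβ_k` (`k ≥ 3` odd) lies in the `π`-sector `M_π = K₀[x_π]`.** -/
theorem of_betaBoxRep_mem_piSector_odd {k : ℕ} (hk : 2 ≤ k) (ho : Odd k) :
    of (betaBoxRep k) ∈ piSector := by
  obtain ⟨n, rfl⟩ : ∃ n, k = n + 2 := ⟨k - 2, by omega⟩
  exact of_betaBoxRep_mem_piSector' ((Nat.odd_add.mp ho).mpr even_two)

/-- **The Kontsevich–Zagier conjecture for the odd `β`-boxes against the `π`-sector**: for odd
`k ≥ 3` and every representation `r'` (any dimension) whose class lies in `M_π` — even zeta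
boxes `B₂, B₄, …`, odd `β`-boxes, tangent / zig / fence cells, their products, rational
multiples of `x_π`-cells — `∫ Bβ_k = ∫ r'` implies that `Bβ_k` and `r'` are connected by the
three moves. -/
theorem kz_betaBox_odd {k m : ℕ} (hk : 2 ≤ k) (ho : Odd k) (r' : IntegralRep m)
    (hr' : of r' ∈ piSector) (hv : (betaBoxRep k).value = r'.value) :
    Equivalent (betaBoxRep k) r' :=
  kz_piSector _ _ (of_betaBoxRep_mem_piSector_odd hk ho) hr' hv

/-- Mixed instance: an even zeta box times an odd `β`-box (`B_j × Bβ_k`, value `ζ(j)β(k)`)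
against anything in `M_π`. -/
theorem kz_boxZeta_mul_betaBox {j k m : ℕ} (hj : 2 ≤ j) (hej : Even j) (hk : 2 ≤ k)
    (hok : Odd k) (r' : IntegralRep m) (hr' : of r' ∈ piSector)
    (hv : ((boxZetaRep j hj).prod (betaBoxRep k)).value = r'.value) :
    Equivalent ((boxZetaRep j hj).prod (betaBoxRep k)) r' :=
  kz_piSector _ _ (by
    rw [← of_mul_of]
    exact piSector.mul_mem (of_boxZetaRep_mem_piSector_even hj hej)
      (of_betaBoxRep_mem_piSector_odd hk hok)) hr' hv

/-! ## The values, read off from the moves -/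

/-- **`∫ Bβ_{n+2} = (n+2)·E_{n+1}·πⁿ⁺²/(2ⁿ⁺³·(n+2)!)`** (`n` odd). -/
theorem betaBoxRep_value_odd (hn : Odd n) :
    (betaBoxRep (n + 2)).value =
      (n + 2) * fenceCount n * π ^ (n + 2) / (2 ^ (n + 3) * (n + 2).factorial) := by
  have h := congrArg evalQ (nsmul_mkQ_betaBox_xPi hn)
  rw [map_nsmul, map_nsmul, map_pow, evalQ_xPi, evalQ_mkQ, eval_of, nsmul_eq_mul, nsmul_eq_mul,
    Nat.cast_mul, Nat.cast_pow, Nat.cast_mul] at h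
  have hN : (0 : ℝ) < 2 ^ (n + 3) * (n + 2).factorial := by positivity
  rw [eq_div_iff hN.ne']
  push_cast at h
  linarith

/-- `∫_{(0,1)³} dx/(1 + (x₁x₂x₃)²) = π³/32` (`= β(3)`), inside the rules. -/
theorem betaBoxRep_value_three : (betaBoxRep 3).value = π ^ 3 / 32 := by
  rw [betaBoxRep_value_odd (n := 1) odd_one, fenceCount_one]
  norm_num [Nat.factorial]
  ring

/-- `∫_{(0,1)⁵} dx/(1 + (x₁⋯x₅)²) = 5π⁵/1536` (`= β(5)`), inside the rules. -/
theorem betaBoxRep_value_five : (betaBoxRep 5).value = 5 * π ^ 5 / 1536 := by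
  rw [betaBoxRep_value_odd (n := 3) (by decide), fenceCount_three]
  norm_num [Nat.factorial]
  ring

/-- `∫_{(0,1)⁷} dx/(1 + (x₁⋯x₇)²) = 61π⁷/184320` (`= β(7)`), inside the rules. -/
theorem betaBoxRep_value_seven : (betaBoxRep 7).value = 61 * π ^ 7 / 184320 := by
  rw [betaBoxRep_value_odd (n := 5) (by decide), fenceCount_five]
  norm_num [Nat.factorial]
  ring

/-- In `Q`: `[Bβ₃] = 32⁻¹·x_π³`. -/
theorem mkQ_betaBox_three : mkQ (of (betaBoxRep 3)) = (32 : K₀)⁻¹ • xPi ^ 3 := by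
  have h : ((2 ^ (1 + 3) * (1 + 2).factorial : ℕ) : K₀) • mkQ (of (betaBoxRep 3)) =
      (((1 + 2) * fenceCount 1 : ℕ) : K₀) • xPi ^ 3 := by
    rw [Nat.cast_smul_eq_nsmul, Nat.cast_smul_eq_nsmul]
    exact nsmul_mkQ_betaBox_xPi (n := 1) odd_one
  rw [fenceCount_one] at h
  norm_num [Nat.factorial] at h
  rw [← inv_smul_smul₀ (by norm_num : (96 : K₀) ≠ 0) (mkQ (of (betaBoxRep 3))), h, smul_smul]
  congr 1
  norm_num

/-! ## A combinatorial identity read off the two chains -/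

/-- **`2·A_k = k·E_{k−1}`** (`k = n + 2`, `n` even): the number `A_k = zigCount n` of cyclically
alternating permutations (the flip chain, `SoloBlindCycFlip`) against the number
`E_{k−1} = fenceCount n` of alternating permutations (the fence chain), obtained with no
combinatorics: both chains express `[T_n, w]` in `Q` through `(2a(1))ᵏ`, and `evalQ` separates. -/
theorem two_mul_zigCount (hn : Even n) : 2 * zigCount n = (n + 2) * fenceCount n := by
  have h1 : ((n + 2).factorial : Q) * mkQ (of (cycPiece n)) =
      (zigCount n : Q) * ((2 : K₀) • alpha 1) ^ (n + 2) := by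
    rw [← nsmul_eq_mul, ← nsmul_eq_mul, mkQ_cycPiece hn, smul_comm,
      factorial_nsmul_simplexPieceK]
  have h2 := nsmul_mkQ_cycPiece_fence n
  rw [nsmul_eq_mul, nsmul_eq_mul] at h2
  push_cast at h1 h2
  have h3 : ((2 * zigCount n : ℕ) : Q) * ((2 : K₀) • alpha 1) ^ (n + 2) =
      (((n + 2) * fenceCount n : ℕ) : Q) * ((2 : K₀) • alpha 1) ^ (n + 2) := by
    push_cast
    linear_combination (-2 : Q) * h1 + h2
  have hy : evalQ ((2 : K₀) • alpha 1) = π / 2 := by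
    have h := evalQ_xPi
    rw [xPi_eq_two_mul, map_mul, map_ofNat] at h
    linarith
  have h4 := congrArg evalQ h3
  rw [map_mul, map_mul, map_pow, map_natCast, map_natCast, hy] at h4
  have hp : (π / 2) ^ (n + 2) ≠ 0 := pow_ne_zero _ (by positivity)
  exact_mod_cast mul_right_cancel₀ hp h4

/-- `A₆ = 48 = 6·16/2`: so `E₅ = fenceCount 4 = 16` without enumerating. -/
theorem fenceCount_four : fenceCount 4 = 16 := by
  have h := two_mul_zigCount (n := 4) (by decide)
  rw [zigCount_four] at h
  omega

end SoloBlind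

end Summit.KontsevichZagierPeriods.KontsevichZagierPeriods.Theorems
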